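import Literature.Geometry.Lorentzian.KerrSmearedPlateHardyIneq
import HarnessLib

/-!
# The smeared plate Hardy inequality (integrated form)

(family `gr`; the (HardyPlate) step of Moschidis, arXiv:1509.08489, proof of Lemma 4.5, in the
smeared-truncation framework; namespace `Literature.Geometry.Lorentzian.Kerr`)

Integrating the pointwise bound `Kerr.plateHardy_bulk_ge` over the wedge between the lower graph
`{t* = s + F₁}` and the leaf `Σ̃_t(h♯_{R₁})`, inserting `Kerr.plateHardy_identity` and dropping the
nonpositive top edge term (`Kerr.plateEdge_top_nonpos`) gives, for an admissible `ψ`, `0 ≤ s ≤ t`,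
every level `T`, with `Q = f ψ̃²`, `f = u_{R',R'}`, `χ = Real.smoothTransition`:

* `Kerr.plateHardy_smeared` (**proved**):
  `½ ∫_y ∫_{t'} χ'(T − t') f ψ̃²/‖y‖²
     ≤ ∫ χ'(T − s − F₁) Q (DF₁(y)[y])/‖y‖² |_{(s + F₁(y), y)} dy      ` (bottom edge; `0` for a slice)
  `  + ∫_y ∫_{t'} χ'(T − t') |Df[(0,y)]| ψ̃²/‖y‖²                         ` (collar)
  `  + 16 ∫_y ∫_{t'} χ'(T − t') f (−(J^T)⁰[ψ̃])                             ` (smeared plate energy),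
  all inner integrals over `t' ∈ (s + F₁(y), t + h♯(y)]`.

The last term is bounded by `Kerr.farLeafFlux_and_plateEnergy_le`; the left side controls the
zeroth-order plate terms of the Morawetz and `r^p` currents. Also: the generic wedge-integral
additivity `E4.integral_integral_Ioc_add` and `Kerr.deriv_smoothTransition_eq_zero_of_nonpos`.
No definitions, no named facts (D-0026).

## References

* G. Moschidis, arXiv:1509.08489, proof of Lemma 4.5, (HardyPlate) (key `Moschidis2016`).
* M. Dafermos, I. Rodnianski, Y. Shlapentokh-Rothman, arXiv:1402.7034, §4.3
  (key `DafermosRodnianskiShlapentokhrothman2014`).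
-/

noncomputable section

open Bundle Set TopologicalSpace Filter MeasureTheory Metric
open scoped Manifold ContDiff Topology ENNReal

namespace Literature.Geometry.Lorentzian

namespace E4

/-- **Additivity of the wedge integrals** `∫_y ∫_{(a(y), b(y)]}` for continuous integrands with the
compact wedge-support property of `E4.integrable_indicator_wedge`. [folklore] -/
theorem integral_integral_Ioc_add {Φ₁ Φ₂ : ℝ → E3 → ℝ}
    (hΦ₁ : Continuous (Function.uncurry Φ₁)) (hΦ₂ : Continuous (Function.uncurry Φ₂))
    {a b : E3 → ℝ} (ha : Continuous a) (hb : Continuous b) {t₀ t₁ ρ : ℝ}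
    (hsupp₁ : ∀ t y, a y < t → t ≤ b y → Φ₁ t y ≠ 0 → t ∈ Set.Icc t₀ t₁ ∧ ‖y‖ ≤ ρ)
    (hsupp₂ : ∀ t y, a y < t → t ≤ b y → Φ₂ t y ≠ 0 → t ∈ Set.Icc t₀ t₁ ∧ ‖y‖ ≤ ρ) :
    ∫ y, ∫ t in Set.Ioc (a y) (b y), (Φ₁ t y + Φ₂ t y) =
      (∫ y, ∫ t in Set.Ioc (a y) (b y), Φ₁ t y) + ∫ y, ∫ t in Set.Ioc (a y) (b y), Φ₂ t y := by
  have hΦ : Continuous (Function.uncurry fun t y ↦ Φ₁ t y + Φ₂ t y) := by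
    have : (Function.uncurry fun t y ↦ Φ₁ t y + Φ₂ t y) =
        fun p ↦ Function.uncurry Φ₁ p + Function.uncurry Φ₂ p := by
      funext p; simp [Function.uncurry]
    rw [this]; exact hΦ₁.add hΦ₂
  have hsupp : ∀ t y, a y < t → t ≤ b y → Φ₁ t y + Φ₂ t y ≠ 0 → t ∈ Set.Icc t₀ t₁ ∧ ‖y‖ ≤ ρ := by
    intro t y h1 h2 hne
    by_cases h : Φ₁ t y = 0
    · exact hsupp₂ t y h1 h2 (by rw [h, zero_add] at hne; exact hne)
    · exact hsupp₁ t y h1 h2 h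
  rw [integral_integral_Ioc_eq_integral_indicator hΦ ha hb hsupp,
    integral_integral_Ioc_eq_integral_indicator hΦ₁ ha hb hsupp₁,
    integral_integral_Ioc_eq_integral_indicator hΦ₂ ha hb hsupp₂,
    ← integral_add (integrable_indicator_wedge hΦ₁ ha hb hsupp₁)
      (integrable_indicator_wedge hΦ₂ ha hb hsupp₂)]
  refine integral_congr_ae (Filter.Eventually.of_forall fun p ↦ ?_)
  by_cases hp : p ∈ {p : ℝ × E3 | a p.2 < p.1 ∧ p.1 ≤ b p.2}
  · simp only [Set.indicator_of_mem hp, Function.uncurry]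
  · simp only [Set.indicator_of_notMem hp, add_zero]

/-- `∫_y ∫_{(a,b]} c Φ = c ∫_y ∫_{(a,b]} Φ`. [folklore] -/
theorem integral_integral_Ioc_const_mul (c : ℝ) (Φ : ℝ → E3 → ℝ) (a b : E3 → ℝ) :
    ∫ y, ∫ t in Set.Ioc (a y) (b y), c * Φ t y = c * ∫ y, ∫ t in Set.Ioc (a y) (b y), Φ t y := by
  rw [← integral_const_mul]
  refine integral_congr_ae (Filter.Eventually.of_forall fun y ↦ ?_)
  exact integral_const_mul _ _

end E4

namespace Kerr

/-- `χ'(σ) = 0` for `σ ≤ 0` (`χ = Real.smoothTransition` is constant on `(−∞, 0]`; cf. the lemma of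
the same content in `Literature/NumberTheory/Automorphic/HyperbolicDirichletForm.lean`, not imported
here). [folklore] -/
theorem deriv_smoothTransition_eq_zero_of_nonpos {σ : ℝ} (hσ : σ ≤ 0) :
    deriv Real.smoothTransition σ = 0 := by
  have hζ : ContDiff ℝ 1 (deriv Real.smoothTransition) :=
    (contDiff_infty_iff_deriv.1 (Real.smoothTransition.contDiff (n := ⊤))).2.of_le
      (by exact_mod_cast le_top)
  rcases lt_or_eq_of_le hσ with hlt | rfl
  · have hev : Real.smoothTransition =ᶠ[𝓝 σ] fun _ ↦ 0 := by
      filter_upwards [(isOpen_gt' (0 : ℝ)).mem_nhds hlt] with ρ hρ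
      exact Real.smoothTransition.zero_of_nonpos (le_of_lt hρ)
    rw [hev.deriv_eq]; simp
  · have hlim : Tendsto (deriv Real.smoothTransition) (𝓝[<] (0 : ℝ))
        (𝓝 (deriv Real.smoothTransition 0)) := hζ.continuous.continuousAt.continuousWithinAt.tendsto
    have hev : deriv Real.smoothTransition =ᶠ[𝓝[<] (0 : ℝ)] fun _ ↦ 0 := by
      filter_upwards [self_mem_nhdsWithin] with ρ hρ
      have hev' : Real.smoothTransition =ᶠ[𝓝 ρ] fun _ ↦ 0 := by
        filter_upwards [(isOpen_gt' (0 : ℝ)).mem_nhds hρ] with ρ' hρ'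
        exact Real.smoothTransition.zero_of_nonpos (le_of_lt hρ')
      rw [hev'.deriv_eq]; simp
    exact tendsto_nhds_unique (hlim.congr' hev) tendsto_const_nhds

variable [Facts] [SliceFacts]

/-- **The smeared plate Hardy inequality** (Moschidis, arXiv:1509.08489, proof of Lemma 4.5,
(HardyPlate), in the smeared-truncation framework): see the module docstring.
[cite: Moschidis2016, Lemma 4.5 (proof, HardyPlate)] -/
theorem plateHardy_smeared {M a R₁ R' : ℝ} (hMa : IsSubextremal M a) (hR₁ : 2 * M < R₁)
    (hR'af : afRadius a (rPlus M a) < R') (hR'9 : 9 * M ≤ R') {ψ : region a (rPlus M a) → ℝ}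
    (hψ : IsAdmissibleKerrWave M a ψ) {ρ₀ : ℝ}
    (hρ₀ : ∀ x : E4, 0 ≤ x 0 → ρ₀ + x 0 < E4.spatialNorm x →
      Function.extend Subtype.val ψ 0 x = 0 ∧ fderiv ℝ (Function.extend Subtype.val ψ 0) x = 0)
    {F₁ : E3 → ℝ} (hF₁ : ContDiff ℝ 2 F₁) (hF₁0 : ∀ y, 0 ≤ F₁ y)
    (hF₁h : ∀ y, F₁ y ≤ scriHeight M a R₁ y) {s t : ℝ} (hs : 0 ≤ s) (hst : s ≤ t) (T : ℝ) :
    (1 / 2) * (∫ y, ∫ t' in Set.Ioc (s + F₁ y) (t + scriHeight M a R₁ y),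
        deriv Real.smoothTransition (T - t') * (radialTransition R' R' y *
          Function.extend Subtype.val ψ 0 (E4.ofTimeSpace t' y) ^ 2) / ‖y‖ ^ 2) ≤
      (∫ y, deriv Real.smoothTransition (T - (s + F₁ y)) *
          ((radialTransition R' R' y * Function.extend Subtype.val ψ 0
              (E4.ofTimeSpace (s + F₁ y) y) ^ 2) * fderiv ℝ F₁ y y / ‖y‖ ^ 2)) +
        (∫ y, ∫ t' in Set.Ioc (s + F₁ y) (t + scriHeight M a R₁ y),
          deriv Real.smoothTransition (T - t') *
            (|fderiv ℝ (fun z : E4 ↦ radialTransition R' R' (E4.spatial z)) (E4.ofTimeSpace t' y)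
                (E4.ofTimeSpace 0 y)| *
              Function.extend Subtype.val ψ 0 (E4.ofTimeSpace t' y) ^ 2) / ‖y‖ ^ 2) +
        16 * ∫ y, ∫ t' in Set.Ioc (s + F₁ y) (t + scriHeight M a R₁ y),
          deriv Real.smoothTransition (T - t') * (radialTransition R' R' y *
            -KerrSchild.multiplierCurrent (inverseMetric M a)
              (fun (_ : E4) (ν : Fin 4) ↦ if ν = 0 then (1 : ℝ) else 0) (Function.extend Subtype.val ψ 0)
              (E4.ofTimeSpace t' y) 0) := by
  have hM : 0 < M := hMa.pos
  have hR' : 0 < R' := (afRadius_pos a (rPlus M a)).trans hR'af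
  have hRp : rPlus M a < R₁ := (rPlus_le_two_mul hM.le).trans_lt hR₁
  set Φ : E4 → ℝ := Function.extend Subtype.val ψ 0 with hΦ
  set f : E4 → ℝ := fun x ↦ radialTransition R' R' (E4.spatial x) with hf
  set Q : E4 → ℝ := fun x ↦ radialTransition R' R' (E4.spatial x) * Φ x ^ 2 with hQ
  set U : Set E4 := {x | afRadius a (rPlus M a) < E4.spatialNorm x} with hU
  set h : E3 → ℝ := scriHeight M a R₁ with hh
  have hF : ContDiff ℝ 2 h := hMa.contDiff_scriHeight hRp
  have hhc : Continuous h := hF.continuous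
  have hF₁c : Continuous F₁ := hF₁.continuous
  have ha : Continuous fun y ↦ s + F₁ y := continuous_const.add hF₁c
  have hb : Continuous fun y ↦ t + h y := continuous_const.add hhc
  have hfU : tsupport f ⊆ U := fun x hx ↦
    hR'af.trans_le (tsupport_radialTransition_comp_spatial_subset hR' hx)
  have hfR : ∀ x ∈ tsupport f, R' ≤ E4.spatialNorm x := fun x hx ↦
    tsupport_radialTransition_comp_spatial_subset hR' hx
  have hf1 : ContDiff ℝ 1 f := contDiff_radialTransition_comp_spatial hR'
  have hmemU : ∀ x ∈ U, x ∈ region a (rPlus M a) := fun x hx ↦ mem_region_of_afRadius_lt_spatialNorm hx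
  have hΦU : ∀ x ∈ U, ContDiffAt ℝ 1 Φ x := fun x hx ↦ hψ.contDiffAt_extend_of_mem (hmemU x hx)
  have hQ1 : ContDiff ℝ 1 Q := by
    have := E4.contDiff_mul_of_tsupport_subset hfU hf1 fun x hx ↦ (hΦU x hx).pow 2
    exact this
  have hQv : ∀ t' (y : E3), Q (E4.ofTimeSpace t' y) = radialTransition R' R' y * Φ (E4.ofTimeSpace t' y) ^ 2 :=
    fun t' y ↦ by simp [hQ, E4.spatial_ofTimeSpace]
  have hζ'c : Continuous fun x : E4 ↦ deriv Real.smoothTransition (T - x 0) :=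
    (Real.smoothTransition.contDiff.continuous_deriv le_rfl).comp
      (continuous_const.sub (E4.dx 0).continuous)
  have hvc : Continuous fun x : E4 ↦ E4.ofTimeSpace 0 (E4.spatial x) :=
    (E4.continuous_ofTimeSpace 0).comp E4.spatial.continuous
  -- ### the four integrands, as functions on `ℝ⁴`
  -- (1) `χ' f Φ² / ρ²`
  have hg1 : ∀ x ∈ U, ContinuousAt (fun x ↦ Φ x ^ 2 / E4.spatialNorm x ^ 2) x := fun x hx ↦
    ((hΦU x hx).continuousAt.pow 2).div ((continuous_norm.comp E4.spatial.continuous).continuousAt.pow 2)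
      (pow_ne_zero 2 ((afRadius_pos a (rPlus M a)).trans hx).ne')
  have hc1 : Continuous fun x : E4 ↦ deriv Real.smoothTransition (T - x 0) *
      (f x * Φ x ^ 2) / E4.spatialNorm x ^ 2 := by
    have := hζ'c.mul (continuous_mul_of_tsupport_subset hfU hf1.continuous hg1)
    exact this.congr fun x ↦ by simp only [Pi.mul_apply]; ring
  -- (2) `χ' |Df[(0,x⃗)]| Φ² / ρ²`
  have hAc : Continuous fun x : E4 ↦ |fderiv ℝ f x (E4.ofTimeSpace 0 (E4.spatial x))| :=
    ((hf1.continuous_fderiv one_ne_zero).clm_apply hvc).abs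
  have hAU : tsupport (fun x : E4 ↦ |fderiv ℝ f x (E4.ofTimeSpace 0 (E4.spatial x))|) ⊆ U := by
    refine (closure_minimal (fun x hx ↦ ?_) (isClosed_tsupport f)).trans hfU
    by_contra hnot
    exact hx (by simp [fderiv_of_notMem_tsupport ℝ hnot])
  have hc2 : Continuous fun x : E4 ↦ deriv Real.smoothTransition (T - x 0) *
      (|fderiv ℝ f x (E4.ofTimeSpace 0 (E4.spatial x))| * Φ x ^ 2) / E4.spatialNorm x ^ 2 := by
    have := hζ'c.mul (continuous_mul_of_tsupport_subset hAU hAc hg1)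
    exact this.congr fun x ↦ by simp only [Pi.mul_apply]; ring
  -- (3) `χ' f (−(J^T)⁰)`
  have hc3 : Continuous fun x : E4 ↦ deriv Real.smoothTransition (T - x 0) * (f x *
      -KerrSchild.multiplierCurrent (inverseMetric M a)
        (fun (_ : E4) (ν : Fin 4) ↦ if ν = 0 then (1 : ℝ) else 0) Φ x 0) := by
    have := (continuous_far_plate_integrand hR'af hψ T).neg
    exact this.congr fun x ↦ by simp only [Pi.neg_apply, hf]; ring
  -- (4) the bulk `χ' (DQ[(0,x⃗)] + Q)/ρ²`
  have hBU : tsupport (fun x : E4 ↦ fderiv ℝ Q x (E4.ofTimeSpace 0 (E4.spatial x)) + Q x) ⊆ U := by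
    have hQU : tsupport Q ⊆ tsupport f :=
      tsupport_mul_subset_left (f := f) (g := fun x ↦ Φ x ^ 2)
    refine (closure_minimal (fun x hx ↦ ?_) (isClosed_tsupport f)).trans hfU
    by_contra hnot
    have hnotQ : x ∉ tsupport Q := fun h' ↦ hnot (hQU h')
    exact hx (by simp [fderiv_of_notMem_tsupport ℝ hnotQ, image_eq_zero_of_notMem_tsupport hnotQ])
  have hBc : Continuous fun x : E4 ↦ fderiv ℝ Q x (E4.ofTimeSpace 0 (E4.spatial x)) + Q x :=
    ((hQ1.continuous_fderiv one_ne_zero).clm_apply hvc).add hQ1.continuous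
  have hinvU : ∀ x ∈ U, ContinuousAt (fun x : E4 ↦ (E4.spatialNorm x ^ 2)⁻¹) x := fun x hx ↦
    (((continuous_norm.comp E4.spatial.continuous).continuousAt.pow 2).inv₀
      (pow_ne_zero 2 ((afRadius_pos a (rPlus M a)).trans hx).ne'))
  have hc4 : Continuous fun x : E4 ↦ deriv Real.smoothTransition (T - x 0) *
      ((fderiv ℝ Q x (E4.ofTimeSpace 0 (E4.spatial x)) + Q x) / E4.spatialNorm x ^ 2) := by
    have := hζ'c.mul (continuous_mul_of_tsupport_subset hBU hBc hinvU)
    exact this.congr fun x ↦ by simp only [Pi.mul_apply, div_eq_mul_inv]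
  -- ### support: below the level `T`, and `Φ = dΦ = 0` beyond `ρ₀ + T`
  have hζ'T : ∀ t', T ≤ t' → deriv Real.smoothTransition (T - t') = 0 := fun t' ht' ↦
    deriv_smoothTransition_eq_zero_of_nonpos (by linarith)
  have hvan : ∀ t' (y : E3), 0 ≤ t' → t' ≤ T → ρ₀ + T < ‖y‖ →
      Φ (E4.ofTimeSpace t' y) = 0 ∧ fderiv ℝ Φ (E4.ofTimeSpace t' y) = 0 := by
    intro t' y h0 hT hy
    refine hρ₀ _ (by rwa [E4.ofTimeSpace_apply_zero]) ?_
    rw [E4.ofTimeSpace_apply_zero, E4.spatialNorm_ofTimeSpace]; linarith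
  -- generic support argument: an integrand of the form `χ'(T − t') · G(t', y)` with `G = 0`
  -- whenever `Φ = dΦ = 0` at `(t', y)`
  have hsuppG : ∀ (G : ℝ → E3 → ℝ),
      (∀ t' y, Φ (E4.ofTimeSpace t' y) = 0 → fderiv ℝ Φ (E4.ofTimeSpace t' y) = 0 → G t' y = 0) →
      ∀ t' y, s + F₁ y < t' → t' ≤ t + h y → deriv Real.smoothTransition (T - t') * G t' y ≠ 0 →
        t' ∈ Set.Icc 0 T ∧ ‖y‖ ≤ ρ₀ + T := by
    intro G hG t' y h1 _ hne
    have ht'0 : 0 ≤ t' := by linarith [hF₁0 y]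
    have ht'T : t' ≤ T := by
      by_contra hlt
      exact hne (by rw [hζ'T t' (le_of_lt (not_le.1 hlt)), zero_mul])
    refine ⟨⟨ht'0, ht'T⟩, ?_⟩
    by_contra hfar
    obtain ⟨hΦ0, hdΦ0⟩ := hvan t' y ht'0 ht'T (not_le.1 hfar)
    exact hne (by rw [hG t' y hΦ0 hdΦ0, mul_zero])
  -- ### the four wedge integrands on `ℝ × E3`
  set Φ1 : ℝ → E3 → ℝ := fun t' y ↦ deriv Real.smoothTransition (T - t') *
    (radialTransition R' R' y * Φ (E4.ofTimeSpace t' y) ^ 2) / ‖y‖ ^ 2 with hΦ1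
  set Φ2 : ℝ → E3 → ℝ := fun t' y ↦ deriv Real.smoothTransition (T - t') *
    (|fderiv ℝ f (E4.ofTimeSpace t' y) (E4.ofTimeSpace 0 y)| * Φ (E4.ofTimeSpace t' y) ^ 2) / ‖y‖ ^ 2
    with hΦ2
  set Φ3 : ℝ → E3 → ℝ := fun t' y ↦ deriv Real.smoothTransition (T - t') * (radialTransition R' R' y *
    -KerrSchild.multiplierCurrent (inverseMetric M a)
      (fun (_ : E4) (ν : Fin 4) ↦ if ν = 0 then (1 : ℝ) else 0) Φ (E4.ofTimeSpace t' y) 0) with hΦ3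
  set Φ4 : ℝ → E3 → ℝ := fun t' y ↦ deriv Real.smoothTransition (T - t') *
    ((fderiv ℝ Q (E4.ofTimeSpace t' y) (E4.ofTimeSpace 0 y) +
      radialTransition R' R' y * Φ (E4.ofTimeSpace t' y) ^ 2) / ‖y‖ ^ 2) with hΦ4
  have hf_of : ∀ t' (y : E3), f (E4.ofTimeSpace t' y) = radialTransition R' R' y := fun t' y ↦ by
    simp [hf, E4.spatial_ofTimeSpace]
  have hΦ1c : Continuous (Function.uncurry Φ1) := by
    refine (hc1.comp E4.continuous_ofTimeSpace_uncurry).congr fun p ↦ ?_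
    simp [hΦ1, Function.uncurry, hf_of, E4.spatialNorm_ofTimeSpace, E4.ofTimeSpace_apply_zero]
  have hΦ2c : Continuous (Function.uncurry Φ2) := by
    refine (hc2.comp E4.continuous_ofTimeSpace_uncurry).congr fun p ↦ ?_
    simp [hΦ2, Function.uncurry, E4.spatial_ofTimeSpace, E4.spatialNorm_ofTimeSpace,
      E4.ofTimeSpace_apply_zero]
  have hΦ3c : Continuous (Function.uncurry Φ3) := by
    refine (hc3.comp E4.continuous_ofTimeSpace_uncurry).congr fun p ↦ ?_
    simp [hΦ3, Function.uncurry, hf_of, E4.ofTimeSpace_apply_zero]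
  have hΦ4c : Continuous (Function.uncurry Φ4) := by
    refine (hc4.comp E4.continuous_ofTimeSpace_uncurry).congr fun p ↦ ?_
    simp [hΦ4, Function.uncurry, E4.spatial_ofTimeSpace, E4.spatialNorm_ofTimeSpace,
      E4.ofTimeSpace_apply_zero, hQv]
  -- supports
  have hJ0 : ∀ t' (y : E3), fderiv ℝ Φ (E4.ofTimeSpace t' y) = 0 →
      KerrSchild.multiplierCurrent (inverseMetric M a)
        (fun (_ : E4) (ν : Fin 4) ↦ if ν = 0 then (1 : ℝ) else 0) Φ (E4.ofTimeSpace t' y) 0 = 0 :=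
    fun t' y hd ↦ KerrSchild.multiplierCurrent_eq_zero_of_fderiv_eq_zero _ _ hd 0
  have hDQ : ∀ t' (y : E3), Φ (E4.ofTimeSpace t' y) = 0 → fderiv ℝ Φ (E4.ofTimeSpace t' y) = 0 →
      fderiv ℝ Q (E4.ofTimeSpace t' y) (E4.ofTimeSpace 0 y) +
        radialTransition R' R' y * Φ (E4.ofTimeSpace t' y) ^ 2 = 0 := by
    intro t' y h0 hd
    have := fderiv_cutoffSq_apply hR'af hψ (E4.ofTimeSpace t' y) (E4.ofTimeSpace 0 y)
    rw [← hΦ] at this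
    change fderiv ℝ (fun z : E4 ↦ radialTransition R' R' (E4.spatial z) * Φ z ^ 2) (E4.ofTimeSpace t' y)
      (E4.ofTimeSpace 0 y) + radialTransition R' R' y * Φ (E4.ofTimeSpace t' y) ^ 2 = 0
    rw [this, h0, hd]
    simp
  have hs1 := hsuppG (fun t' y ↦ (radialTransition R' R' y * Φ (E4.ofTimeSpace t' y) ^ 2) / ‖y‖ ^ 2)
    (fun t' y h0 _ ↦ by simp [h0])
  have hs2 := hsuppG (fun t' y ↦ (|fderiv ℝ f (E4.ofTimeSpace t' y) (E4.ofTimeSpace 0 y)| *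
    Φ (E4.ofTimeSpace t' y) ^ 2) / ‖y‖ ^ 2) (fun t' y h0 _ ↦ by simp [h0])
  have hs3 := hsuppG (fun t' y ↦ radialTransition R' R' y *
    -KerrSchild.multiplierCurrent (inverseMetric M a)
      (fun (_ : E4) (ν : Fin 4) ↦ if ν = 0 then (1 : ℝ) else 0) Φ (E4.ofTimeSpace t' y) 0)
    (fun t' y _ hd ↦ by simp [hJ0 t' y hd])
  have hs4 := hsuppG (fun t' y ↦ (fderiv ℝ Q (E4.ofTimeSpace t' y) (E4.ofTimeSpace 0 y) +
    radialTransition R' R' y * Φ (E4.ofTimeSpace t' y) ^ 2) / ‖y‖ ^ 2) (fun t' y h0 hd ↦ by simp [hDQ t' y h0 hd])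
  have hsupp1 : ∀ t' y, s + F₁ y < t' → t' ≤ t + h y → Φ1 t' y ≠ 0 → t' ∈ Set.Icc 0 T ∧ ‖y‖ ≤ ρ₀ + T :=
    fun t' y h1 h2 hne ↦ hs1 t' y h1 h2 (by simpa [hΦ1, mul_div_assoc] using hne)
  have hsupp2 : ∀ t' y, s + F₁ y < t' → t' ≤ t + h y → Φ2 t' y ≠ 0 → t' ∈ Set.Icc 0 T ∧ ‖y‖ ≤ ρ₀ + T :=
    fun t' y h1 h2 hne ↦ hs2 t' y h1 h2 (by simpa [hΦ2, mul_div_assoc] using hne)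
  have hsupp3 : ∀ t' y, s + F₁ y < t' → t' ≤ t + h y → Φ3 t' y ≠ 0 → t' ∈ Set.Icc 0 T ∧ ‖y‖ ≤ ρ₀ + T :=
    fun t' y h1 h2 hne ↦ hs3 t' y h1 h2 (by simpa [hΦ3] using hne)
  have hsupp4 : ∀ t' y, s + F₁ y < t' → t' ≤ t + h y → Φ4 t' y ≠ 0 → t' ∈ Set.Icc 0 T ∧ ‖y‖ ≤ ρ₀ + T :=
    fun t' y h1 h2 hne ↦ hs4 t' y h1 h2 (by simpa [hΦ4] using hne)
  -- ### the pointwise bound and its integral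
  set L : ℝ → E3 → ℝ := fun t' y ↦ (1 / 2) * Φ1 t' y + (-Φ2 t' y + (-16) * Φ3 t' y) with hL
  have hLc : Continuous (Function.uncurry L) := by
    have : Function.uncurry L = fun p ↦ (1 / 2) * Function.uncurry Φ1 p +
        (-Function.uncurry Φ2 p + (-16) * Function.uncurry Φ3 p) := by
      funext p; simp [hL, Function.uncurry]
    rw [this]
    exact (continuous_const.mul hΦ1c).add (hΦ2c.neg.add (continuous_const.mul hΦ3c))
  have hsuppL : ∀ t' y, s + F₁ y < t' → t' ≤ t + h y → L t' y ≠ 0 → t' ∈ Set.Icc 0 T ∧ ‖y‖ ≤ ρ₀ + T := by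
    intro t' y h1 h2 hne
    by_cases k1 : Φ1 t' y ≠ 0
    · exact hsupp1 t' y h1 h2 k1
    by_cases k2 : Φ2 t' y ≠ 0
    · exact hsupp2 t' y h1 h2 k2
    by_cases k3 : Φ3 t' y ≠ 0
    · exact hsupp3 t' y h1 h2 k3
    push Not at k1 k2 k3
    exact absurd (by simp [hL, k1, k2, k3]) hne
  have hle : ∀ t' y, s + F₁ y < t' → t' ≤ t + h y → L t' y ≤ Φ4 t' y := by
    intro t' y _ _
    have hpt := plateHardy_bulk_ge hMa hR'af hR'9 hψ T (E4.ofTimeSpace t' y)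
    rw [← hΦ] at hpt
    rw [← hQ, ← hf] at hpt
    simp only [E4.ofTimeSpace_apply_zero, E4.spatial_ofTimeSpace, E4.spatialNorm_ofTimeSpace] at hpt
    simp only [hL, hΦ1, hΦ2, hΦ3, hΦ4]
    have e1 : deriv Real.smoothTransition (T - t') * (radialTransition R' R' y * Φ (E4.ofTimeSpace t' y) ^ 2) /
        ‖y‖ ^ 2 = deriv Real.smoothTransition (T - t') * (radialTransition R' R' y * Φ (E4.ofTimeSpace t' y) ^ 2 /
        ‖y‖ ^ 2) := by ring
    have e2 : deriv Real.smoothTransition (T - t') *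
        (|fderiv ℝ f (E4.ofTimeSpace t' y) (E4.ofTimeSpace 0 y)| * Φ (E4.ofTimeSpace t' y) ^ 2) / ‖y‖ ^ 2 =
        deriv Real.smoothTransition (T - t') *
        (|fderiv ℝ f (E4.ofTimeSpace t' y) (E4.ofTimeSpace 0 y)| * Φ (E4.ofTimeSpace t' y) ^ 2 / ‖y‖ ^ 2) := by
      ring
    rw [e1, e2]
    have e3 : deriv Real.smoothTransition (T - t') *
        ((1 / 2 * radialTransition R' R' y * Φ (E4.ofTimeSpace t' y) ^ 2 -
          |fderiv ℝ f (E4.ofTimeSpace t' y) (E4.ofTimeSpace 0 y)| * Φ (E4.ofTimeSpace t' y) ^ 2) / ‖y‖ ^ 2) =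
        1 / 2 * (deriv Real.smoothTransition (T - t') * (radialTransition R' R' y * Φ (E4.ofTimeSpace t' y) ^ 2 /
          ‖y‖ ^ 2)) - deriv Real.smoothTransition (T - t') *
          (|fderiv ℝ f (E4.ofTimeSpace t' y) (E4.ofTimeSpace 0 y)| * Φ (E4.ofTimeSpace t' y) ^ 2 / ‖y‖ ^ 2) := by
      ring
    rw [e3] at hpt
    linarith [hpt]
  have hmono : ∫ y, ∫ t' in Set.Ioc (s + F₁ y) (t + h y), L t' y ≤
      ∫ y, ∫ t' in Set.Ioc (s + F₁ y) (t + h y), Φ4 t' y :=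
    E4.integral_integral_Ioc_mono hLc hΦ4c ha hb hsuppL hsupp4 hle
  -- ### split the left integral
  have hsplit : ∫ y, ∫ t' in Set.Ioc (s + F₁ y) (t + h y), L t' y =
      (1 / 2) * (∫ y, ∫ t' in Set.Ioc (s + F₁ y) (t + h y), Φ1 t' y) +
        (-(∫ y, ∫ t' in Set.Ioc (s + F₁ y) (t + h y), Φ2 t' y) +
          (-16) * ∫ y, ∫ t' in Set.Ioc (s + F₁ y) (t + h y), Φ3 t' y) := by
    have hA : Continuous (Function.uncurry fun t' y ↦ (1 / 2) * Φ1 t' y) := by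
      have : (Function.uncurry fun t' y ↦ (1 / 2) * Φ1 t' y) = fun p ↦ (1 / 2) * Function.uncurry Φ1 p := by
        funext p; simp [Function.uncurry]
      rw [this]; exact continuous_const.mul hΦ1c
    have hB : Continuous (Function.uncurry fun t' y ↦ -Φ2 t' y) := hΦ2c.neg
    have hC : Continuous (Function.uncurry fun t' y ↦ (-16) * Φ3 t' y) := by
      have : (Function.uncurry fun t' y ↦ (-16) * Φ3 t' y) = fun p ↦ (-16) * Function.uncurry Φ3 p := by
        funext p; simp [Function.uncurry]
      rw [this]; exact continuous_const.mul hΦ3c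
    have hBC : Continuous (Function.uncurry fun t' y ↦ -Φ2 t' y + (-16) * Φ3 t' y) := by
      have : (Function.uncurry fun t' y ↦ -Φ2 t' y + (-16) * Φ3 t' y) =
          fun p ↦ Function.uncurry (fun t' y ↦ -Φ2 t' y) p + Function.uncurry (fun t' y ↦ (-16) * Φ3 t' y) p := by
        funext p; simp [Function.uncurry]
      rw [this]; exact hB.add hC
    have hsA : ∀ t' y, s + F₁ y < t' → t' ≤ t + h y → (1 / 2) * Φ1 t' y ≠ 0 →
        t' ∈ Set.Icc 0 T ∧ ‖y‖ ≤ ρ₀ + T := fun t' y h1 h2 hne ↦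
      hsupp1 t' y h1 h2 (by intro h0; exact hne (by rw [h0, mul_zero]))
    have hsB : ∀ t' y, s + F₁ y < t' → t' ≤ t + h y → -Φ2 t' y ≠ 0 →
        t' ∈ Set.Icc 0 T ∧ ‖y‖ ≤ ρ₀ + T := fun t' y h1 h2 hne ↦
      hsupp2 t' y h1 h2 (neg_ne_zero.1 hne)
    have hsC : ∀ t' y, s + F₁ y < t' → t' ≤ t + h y → (-16) * Φ3 t' y ≠ 0 →
        t' ∈ Set.Icc 0 T ∧ ‖y‖ ≤ ρ₀ + T := fun t' y h1 h2 hne ↦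
      hsupp3 t' y h1 h2 (by intro h0; exact hne (by rw [h0, mul_zero]))
    have hsBC : ∀ t' y, s + F₁ y < t' → t' ≤ t + h y → -Φ2 t' y + (-16) * Φ3 t' y ≠ 0 →
        t' ∈ Set.Icc 0 T ∧ ‖y‖ ≤ ρ₀ + T := by
      intro t' y h1 h2 hne
      by_cases k : -Φ2 t' y = 0
      · exact hsC t' y h1 h2 (by rw [k, zero_add] at hne; exact hne)
      · exact hsB t' y h1 h2 k
    rw [show (fun y ↦ ∫ t' in Set.Ioc (s + F₁ y) (t + h y), L t' y) = fun y ↦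
        ∫ t' in Set.Ioc (s + F₁ y) (t + h y), ((1 / 2) * Φ1 t' y + (-Φ2 t' y + (-16) * Φ3 t' y)) from rfl,
      E4.integral_integral_Ioc_add hA hBC ha hb hsA hsBC, E4.integral_integral_Ioc_add hB hC ha hb hsB hsC,
      E4.integral_integral_Ioc_const_mul, E4.integral_integral_Ioc_const_mul]
    congr 2
    rw [← integral_neg]
    refine integral_congr_ae (Filter.Eventually.of_forall fun y ↦ ?_)
    exact integral_neg _
  -- ### the identity and the sign of the top edge term
  have hid := plateHardy_identity hMa hR₁ hR'af hψ hρ₀ hF₁ hF₁0 hF₁h hs hst T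
  have htop : (∫ y, deriv Real.smoothTransition (T - (t + scriHeight M a R₁ y)) *
      -((radialTransition R' R' y * Function.extend Subtype.val ψ 0
          (E4.ofTimeSpace (t + scriHeight M a R₁ y) y) ^ 2) *
        fderiv ℝ (scriHeight M a R₁) y y / ‖y‖ ^ 2)) ≤ 0 :=
    integral_nonpos fun y ↦ plateEdge_top_nonpos hMa hR₁ ψ t T y
  have hΦ4id : (∫ y, ∫ t' in Set.Ioc (s + F₁ y) (t + h y), Φ4 t' y) =
      ∫ y, ∫ t' in Set.Ioc (s + F₁ y) (t + scriHeight M a R₁ y),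
        deriv Real.smoothTransition (T - t') *
          ((fderiv ℝ (fun x : E4 ↦ radialTransition R' R' (E4.spatial x) *
              Function.extend Subtype.val ψ 0 x ^ 2) (E4.ofTimeSpace t' y) (E4.ofTimeSpace 0 y) +
            radialTransition R' R' y * Function.extend Subtype.val ψ 0 (E4.ofTimeSpace t' y) ^ 2) /
            ‖y‖ ^ 2) := by
    rfl
  have hbot : (∫ y, deriv Real.smoothTransition (T - (s + F₁ y)) *
        -((radialTransition R' R' y * Function.extend Subtype.val ψ 0
            (E4.ofTimeSpace (s + F₁ y) y) ^ 2) * fderiv ℝ F₁ y y / ‖y‖ ^ 2)) =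
      -∫ y, deriv Real.smoothTransition (T - (s + F₁ y)) *
        ((radialTransition R' R' y * Function.extend Subtype.val ψ 0
            (E4.ofTimeSpace (s + F₁ y) y) ^ 2) * fderiv ℝ F₁ y y / ‖y‖ ^ 2) := by
    rw [← integral_neg]
    refine integral_congr_ae (Filter.Eventually.of_forall fun y ↦ ?_)
    ring
  rw [hbot] at hid
  -- ### conclusion
  rw [hsplit, hΦ4id, ← hid] at hmono
  have h2 : (∫ y, ∫ t' in Set.Ioc (s + F₁ y) (t + h y), Φ2 t' y) =
      ∫ y, ∫ t' in Set.Ioc (s + F₁ y) (t + scriHeight M a R₁ y),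
        deriv Real.smoothTransition (T - t') *
          (|fderiv ℝ (fun z : E4 ↦ radialTransition R' R' (E4.spatial z)) (E4.ofTimeSpace t' y)
              (E4.ofTimeSpace 0 y)| *
            Function.extend Subtype.val ψ 0 (E4.ofTimeSpace t' y) ^ 2) / ‖y‖ ^ 2 := rfl
  rw [h2] at hmono
  linarith [hmono, htop]

end Kerr

end Literature.Geometry.Lorentzian
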